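import Literature.NumberTheory.Automorphic.ChevalleyIntegrable
import Literature.NumberTheory.Automorphic.ChevalleyGroupData
import Mathlib.LinearAlgebra.Matrix.ToLin
import Mathlib.Algebra.DirectSum.Module
import HarnessLib

/-!
# The block of root matrices of `L(Λ)` (a `RootRepBlock`)

Trunk T-AUTOMORPHIC (G25 AutomorphicL); highest-weight theory for Chevalley's existence theorem
(`Literature.NumberTheory.Automorphic.chevalley_existence`, Springer 10.1.1), step 5 after
`ChevalleyIntegrable.lean`. For a Chevalley system `S`, a dominant `Λ ∈ X`
(`hdom : RootDatumWeights.IsDominant P b Λ`), over an algebraically closed field of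
characteristic `0`:

* the finite set of weights `wtFinset` of `L(Λ)`, enumerated (`wtAt`), the **weight decomposition**
  `L(Λ) = ⊕_μ L(Λ)_μ` (`isInternal_pieceAt`) and the **weight basis** `blkBasis` (Mathlib
  `DirectSum.IsInternal.collectedBasis`) indexed by `BlkIdx S Λ hdom = Σ j, Fin d_j`, with weights
  `blkWt`;
* the **representation `blkRep : L →ₗ⁅k⁆ Matrix` in the weight basis** (Mathlib
  `LinearMap.toMatrixAlgEquiv` composed with `LieModule.toEnd`): `ρ(h_s) = diag (⟨wt a, α_s^∨⟩)`
  (`blkRep_h`), `ρ(e_α)` is homogeneous of degree `α` (`isHomogMat_blkRep_e`),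
  `[ρ(e_α), ρ(e_{-α})] = H_α` (`blkRep_e_mul_e_neg_sub`), irreducibility in coordinates
  (`blk_irreducible`, from the irreducibility of `L(Λ)`), weights in `Λ +` root lattice, trace
  condition (`sum_blkWt_coroot`);
* packaged as **`blk S Λ hdom : RootRepBlock k P (BlkIdx S Λ hdom)`** (`ChevalleyGroupData.lean`),
  with `Λ` and (for `⟨Λ, α_s^∨⟩ > 0`) `Λ - α_s` among the weights (`exists_blkWt_eq_self`,
  `exists_blkWt_eq_sub`).

Everything is proved; statements are [folklore] (Humphreys §20–21; Steinberg, *Lectures on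
Chevalley groups*, §3). Nothing here duplicates Mathlib or the tree.
-/

noncomputable section

open Set Function Finsupp UniversalEnvelopingAlgebra LieModule
open Literature.Algebra.Lie.PBW

attribute [local instance 100] LieRing.ofAssociativeRing

namespace Literature.NumberTheory.Automorphic

namespace ChevalleyVerma

variable {k : Type*} [Field k] [CharZero k] [IsAlgClosed k]
variable {ι X Y : Type*} [AddCommGroup X] [AddCommGroup Y] [Fintype ι] [DecidableEq ι]
variable {P : RootPairing ι ℤ X Y} {b : P.Base} [Module.Finite ℤ X] [P.IsReduced]
variable {L : Type*} [LieRing L] [LieAlgebra k L] {h : b.support → L} {e : ι → L}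
  (S : IsChevalleySystem P b k h e) (Λ : X) (hdom : RootDatumWeights.IsDominant P b Λ)

/-! ### The weights of `L(Λ)`, enumerated, and the weight decomposition -/

/-- The finite set of weights of `L(Λ)`. [folklore] -/
def wtFinset : Finset X := (wtSet_finite S Λ hdom).toFinset

/-- Membership in `wtFinset`. [folklore] -/
lemma mem_wtFinset_iff (μ : X) : μ ∈ wtFinset S Λ hdom ↔ wspL S (xChar b k Λ) (μ - Λ) ≠ ⊥ := by
  rw [wtFinset, Set.Finite.mem_toFinset, mem_wtSet_iff]

/-- The number of weights. [folklore] -/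
def nWt : ℕ := (wtFinset S Λ hdom).card

/-- An enumeration of the weights. [folklore] -/
def wtAt (j : Fin (nWt S Λ hdom)) : X := ((wtFinset S Λ hdom).equivFin.symm j : X)

/-- The enumerated weights are weights. [folklore] -/
lemma wtAt_mem (j : Fin (nWt S Λ hdom)) : wtAt S Λ hdom j ∈ wtFinset S Λ hdom :=
  ((wtFinset S Λ hdom).equivFin.symm j).2

/-- The enumeration is injective. [folklore] -/
lemma wtAt_injective : Function.Injective (wtAt S Λ hdom) := fun _ _ hjj' =>
  (wtFinset S Λ hdom).equivFin.symm.injective (Subtype.ext hjj')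

/-- Every weight is enumerated. [folklore] -/
lemma exists_wtAt_eq {μ : X} (hμ : μ ∈ wtFinset S Λ hdom) : ∃ j, wtAt S Λ hdom j = μ :=
  ⟨(wtFinset S Λ hdom).equivFin ⟨μ, hμ⟩, by simp [wtAt]⟩

/-- The weight spaces, enumerated. [folklore] -/
def pieceAt (j : Fin (nWt S Λ hdom)) : Submodule k (Irr S (xChar b k Λ)) :=
  wspL S (xChar b k Λ) (wtAt S Λ hdom j - Λ)

/-- The enumerated weight spaces are independent. [folklore] -/
lemma iSupIndep_pieceAt : iSupIndep (pieceAt S Λ hdom) :=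
  (iSupIndep_wspL S (xChar b k Λ)).comp (f := fun j => wtAt S Λ hdom j - Λ)
    fun _ _ hjj' => wtAt_injective S Λ hdom (sub_left_injective hjj')

/-- The enumerated weight spaces span `L(Λ)`. [folklore] -/
lemma iSup_pieceAt_eq_top : ⨆ j, pieceAt S Λ hdom j = ⊤ := by
  rw [eq_top_iff, ← iSup_wspL_eq_top S]
  refine iSup_le fun y => ?_
  by_cases hy : wspL S (xChar b k Λ) y = ⊥
  · rw [hy]; exact bot_le
  · have hmem : Λ + y ∈ wtFinset S Λ hdom := by
      rw [mem_wtFinset_iff, add_sub_cancel_left]; exact hy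
    obtain ⟨j, hj⟩ := exists_wtAt_eq S Λ hdom hmem
    refine le_iSup_of_le j (le_of_eq ?_)
    rw [pieceAt, hj, add_sub_cancel_left]

/-- **The weight decomposition `L(Λ) = ⊕_μ L(Λ)_μ`.** [folklore] -/
theorem isInternal_pieceAt : DirectSum.IsInternal (pieceAt S Λ hdom) :=
  (DirectSum.isInternal_submodule_iff_iSupIndep_and_iSup_eq_top _).2
    ⟨iSupIndep_pieceAt S Λ hdom, iSup_pieceAt_eq_top S Λ hdom⟩

/-! ### The weight basis -/

/-- The weight spaces are finite-dimensional. [folklore] -/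
instance finiteDimensional_pieceAt (j : Fin (nWt S Λ hdom)) : FiniteDimensional k (pieceAt S Λ hdom j) :=
  inferInstanceAs (FiniteDimensional k (wspL S (xChar b k Λ) (wtAt S Λ hdom j - Λ)))

/-- The dimensions of the weight spaces. [folklore] -/
def blkDim (j : Fin (nWt S Λ hdom)) : ℕ := Module.finrank k (pieceAt S Λ hdom j)

/-- **The index type of the weight basis of `L(Λ)`**: pairs (weight, index within the weight
space). [folklore] -/
def BlkIdx : Type := Σ j : Fin (nWt S Λ hdom), Fin (blkDim S Λ hdom j)

/-- Finiteness of the index type. [folklore] -/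
instance : Fintype (BlkIdx S Λ hdom) :=
  inferInstanceAs (Fintype (Σ j : Fin (nWt S Λ hdom), Fin (blkDim S Λ hdom j)))

/-- Decidable equality of the index type. [folklore] -/
instance : DecidableEq (BlkIdx S Λ hdom) :=
  inferInstanceAs (DecidableEq (Σ j : Fin (nWt S Λ hdom), Fin (blkDim S Λ hdom j)))

/-- **The weight basis of `L(Λ)`** (bases of the weight spaces, collected). [folklore] -/
def blkBasis : Module.Basis (BlkIdx S Λ hdom) k (Irr S (xChar b k Λ)) :=
  (isInternal_pieceAt S Λ hdom).collectedBasis fun j => Module.finBasis k (pieceAt S Λ hdom j)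

/-- The weight of a basis vector. [folklore] -/
def blkWt (a : BlkIdx S Λ hdom) : X := wtAt S Λ hdom a.1

/-- **Basis vectors are weight vectors.** [folklore] -/
theorem blkBasis_mem (a : BlkIdx S Λ hdom) :
    blkBasis S Λ hdom a ∈ wspL S (xChar b k Λ) (blkWt S Λ hdom a - Λ) :=
  (isInternal_pieceAt S Λ hdom).collectedBasis_mem _ a

/-- Coordinates of a weight vector vanish outside its weight. [folklore] -/
theorem repr_eq_zero_of_mem_pieceAt {v : Irr S (xChar b k Λ)} {j : Fin (nWt S Λ hdom)}
    (hv : v ∈ pieceAt S Λ hdom j) (a : BlkIdx S Λ hdom) (ha : a.1 ≠ j) :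
    (blkBasis S Λ hdom).repr v a = 0 := by
  rcases a with ⟨j', c⟩
  exact (isInternal_pieceAt S Λ hdom).collectedBasis_repr_of_mem_ne _ (Ne.symm ha) hv

/-- The weights lie in `Λ +` root lattice. [folklore] -/
theorem blkWt_sub_mem_rootSpan (a : BlkIdx S Λ hdom) : blkWt S Λ hdom a - Λ ∈ P.rootSpan ℤ := by
  by_contra hn
  have h1 := (mem_wtFinset_iff S Λ hdom _).1 (wtAt_mem S Λ hdom a.1)
  exact h1 (wspL_eq_bot_of_notMem S _ hn)

/-! ### The representation in the weight basis -/

/-- **The representation of `L` on `L(Λ)` in the weight basis**, a morphism of Lie algebras into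
matrices (commutator bracket). [folklore] -/
def blkRep : L →ₗ⁅k⁆ Matrix (BlkIdx S Λ hdom) (BlkIdx S Λ hdom) k :=
  ((LinearMap.toMatrixAlgEquiv (blkBasis S Λ hdom)).toAlgHom.toLieHom).comp
    (LieModule.toEnd k L (Irr S (xChar b k Λ)))

/-- Entries of the representation matrices. [folklore] -/
lemma blkRep_apply (x : L) (a c : BlkIdx S Λ hdom) :
    blkRep S Λ hdom x a c = (blkBasis S Λ hdom).repr ⁅x, blkBasis S Λ hdom c⁆ a := by
  change LinearMap.toMatrixAlgEquiv (blkBasis S Λ hdom) (LieModule.toEnd k L _ x) a c = _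
  rw [LinearMap.toMatrixAlgEquiv_apply, toEnd_apply_apply]

/-- The representation is a morphism for the commutator bracket. [folklore] -/
lemma blkRep_lie (x y : L) :
    blkRep S Λ hdom ⁅x, y⁆ = blkRep S Λ hdom x * blkRep S Λ hdom y - blkRep S Λ hdom y * blkRep S Λ hdom x := by
  rw [LieHom.map_lie, LieRing.of_associative_ring_bracket]

/-- **`h_s` acts by the diagonal matrix `diag (⟨wt a, α_s^∨⟩)`.** [folklore] -/
theorem blkRep_h (s : b.support) : blkRep S Λ hdom (h s) = torusDiag (blkWt S Λ hdom) (corootForm (k := k) P s) := by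
  ext a c
  rw [blkRep_apply, lie_h_of_mem_wspL S _ (blkBasis_mem S Λ hdom c) s, map_smul, Finsupp.smul_apply,
    Module.Basis.repr_self, smul_eq_mul, torusDiag_apply, corootForm_apply, Finsupp.single_apply]
  by_cases hac : a = c
  · subst hac
    rw [if_pos rfl, if_pos rfl, mul_one, xChar_apply, xChar_apply, ← Int.cast_add, ← LinearMap.add_apply,
      ← map_add, add_sub_cancel]
  · rw [if_neg (Ne.symm hac), if_neg hac, mul_zero]

/-- **`e_α` is homogeneous of degree `α` in the weight basis.** [folklore] -/
theorem isHomogMat_blkRep_e (i : ι) : IsHomogMat (blkWt S Λ hdom) (P.root i) (blkRep S Λ hdom (e i)) := by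
  intro a c hac
  rw [blkRep_apply] at hac
  have hmem : ⁅e i, blkBasis S Λ hdom c⁆ ∈ wspL S (xChar b k Λ) (blkWt S Λ hdom c - Λ + P.root i) :=
    lie_e_mem_wspL S _ (blkWt_sub_mem_rootSpan S Λ hdom c) (blkBasis_mem S Λ hdom c) i
  -- the target weight is a weight, with some index `j`
  have hne : wspL S (xChar b k Λ) (blkWt S Λ hdom c - Λ + P.root i) ≠ ⊥ := by
    intro h0
    rw [h0, Submodule.mem_bot] at hmem
    rw [hmem, map_zero, Finsupp.zero_apply] at hac
    exact hac rfl
  have hwt : blkWt S Λ hdom c + P.root i ∈ wtFinset S Λ hdom := by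
    rw [mem_wtFinset_iff, show blkWt S Λ hdom c + P.root i - Λ = blkWt S Λ hdom c - Λ + P.root i by abel]
    exact hne
  obtain ⟨j, hj⟩ := exists_wtAt_eq S Λ hdom hwt
  have hmem' : ⁅e i, blkBasis S Λ hdom c⁆ ∈ pieceAt S Λ hdom j := by
    rw [pieceAt, hj, show blkWt S Λ hdom c + P.root i - Λ = blkWt S Λ hdom c - Λ + P.root i by abel]
    exact hmem
  have haj : a.1 = j := by
    by_contra hne'
    exact hac (repr_eq_zero_of_mem_pieceAt S Λ hdom hmem' a hne')
  change wtAt S Λ hdom a.1 = _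
  rw [haj, hj, blkWt]

/-- **`[E_α, E_{-α}] = H_α`** in the weight basis. [folklore] -/
theorem blkRep_e_mul_e_neg_sub (i : ι) :
    blkRep S Λ hdom (e i) * blkRep S Λ hdom (e (P.reflectionPerm i i)) -
      blkRep S Λ hdom (e (P.reflectionPerm i i)) * blkRep S Λ hdom (e i) =
        hMat P (blkWt S Λ hdom) i := by
  rw [← blkRep_lie, S.lie_e_neg, map_sum]
  ext a c
  rw [Matrix.sum_apply, hMat_apply, toLinearMap_coroot_eq_sum P b (blkWt S Λ hdom a) i, Int.cast_sum]
  have hterm : ∀ s : b.support, blkRep S Λ hdom (((corootCoord P b i s : ℤ) : k) • h s) a c =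
      if a = c then ((corootCoord P b i s : ℤ) : k) * ((P.toLinearMap (blkWt S Λ hdom a) (P.coroot s) : ℤ) : k)
      else 0 := by
    intro s
    rw [map_smul, Matrix.smul_apply, blkRep_h, torusDiag_apply, corootForm_apply, smul_eq_mul]
    split_ifs <;> simp
  simp_rw [hterm]
  split_ifs with hac
  · exact Finset.sum_congr rfl fun s _ => by rw [Int.cast_mul]
  · exact Finset.sum_const_zero

/-! ### Irreducibility in coordinates -/

/-- The representation matrix is `LinearMap.toMatrix` of the action. [folklore] -/
lemma blkRep_eq_toMatrix (x : L) :
    blkRep S Λ hdom x = LinearMap.toMatrix (blkBasis S Λ hdom) (blkBasis S Λ hdom) (toEnd k L _ x) := rfl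

/-- **Coordinates intertwine the action and the representation matrices**:
`coords ⁅x, v⁆ = ρ(x) · coords v`. [folklore] -/
theorem blkRep_mulVec_repr (x : L) (v : Irr S (xChar b k Λ)) :
    (blkRep S Λ hdom x).mulVec ⇑((blkBasis S Λ hdom).repr v) = ⇑((blkBasis S Λ hdom).repr ⁅x, v⁆) := by
  rw [blkRep_eq_toMatrix, LinearMap.toMatrix_mulVec_repr, toEnd_apply_apply]

/-- **Irreducibility of the block**: a subspace of coordinate vectors stable under the root
matrices `ρ(e_α)` and the torus Lie algebra `𝔱_V` (which contains the `ρ(h_s)`) is `⊥` or `⊤`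
(irreducibility of `L(Λ)`). [folklore] -/
theorem blk_irreducible (W : Submodule k (BlkIdx S Λ hdom → k))
    (hE : ∀ i, ∀ v ∈ W, (blkRep S Λ hdom (e i)).mulVec v ∈ W)
    (hT : ∀ ℓ : X →+ k, ∀ v ∈ W, (torusDiag (blkWt S Λ hdom) ℓ).mulVec v ∈ W) : W = ⊥ ∨ W = ⊤ := by
  set B := blkBasis S Λ hdom with hB
  set f : Irr S (xChar b k Λ) →ₗ[k] (BlkIdx S Λ hdom → k) := B.equivFun.toLinearMap with hf
  have hfv : ∀ v, f v = ⇑(B.repr v) := fun v => rfl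
  set W' : Submodule k (Irr S (xChar b k Λ)) := W.comap f with hW'
  -- `W'` is stable under the basis vectors of `L`, hence under `L`
  have hbasis : ∀ (j : b.support ⊕ ι), ∀ v ∈ W', ⁅S.basis j, v⁆ ∈ W' := by
    intro j v hv
    rw [hW', Submodule.mem_comap, hfv] at hv ⊢
    rw [← blkRep_mulVec_repr]
    rcases j with s | i
    · rw [IsChevalleySystem.coe_basis, Sum.elim_inl, blkRep_h]
      exact hT _ _ hv
    · rw [IsChevalleySystem.coe_basis, Sum.elim_inr]
      exact hE i _ hv
  have hL : ∀ (x : L), ∀ v ∈ W', ⁅x, v⁆ ∈ W' := by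
    intro x v hv
    rw [← S.basis.sum_repr x, sum_lie]
    refine Submodule.sum_mem _ fun j _ => ?_
    rw [smul_lie]
    exact Submodule.smul_mem _ _ (hbasis j v hv)
  have hsurj : Function.Surjective f := B.equivFun.surjective
  rcases eq_bot_or_eq_top_of_forall_lie_mem S _ W' hL with h0 | h1
  · left
    rw [← Submodule.map_comap_eq_of_surjective hsurj W, ← hW', h0, Submodule.map_bot]
  · right
    rw [← Submodule.map_comap_eq_of_surjective hsurj W, ← hW', h1, Submodule.map_top]
    exact LinearMap.range_eq_top.2 hsurj

/-! ### The block -/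

/-- Weights of the block are congruent modulo the root lattice. [folklore] -/
theorem blkWt_sub_blkWt_mem (a c : BlkIdx S Λ hdom) :
    blkWt S Λ hdom a - blkWt S Λ hdom c ∈ AddSubgroup.closure (Set.range P.root) := by
  rw [← Submodule.span_int_eq_addSubgroupClosure, Submodule.mem_toAddSubgroup,
    show blkWt S Λ hdom a - blkWt S Λ hdom c = (blkWt S Λ hdom a - Λ) - (blkWt S Λ hdom c - Λ) by abel]
  exact Submodule.sub_mem _ (blkWt_sub_mem_rootSpan S Λ hdom a) (blkWt_sub_mem_rootSpan S Λ hdom c)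

/-- **The sum of the weights is orthogonal to every coroot** (it is the trace of
`H_α = [E_α, E_{-α}]`). [folklore] -/
theorem sum_blkWt_coroot (i : ι) : P.toLinearMap (∑ a, blkWt S Λ hdom a) (P.coroot i) = 0 := by
  have htr := congrArg Matrix.trace (blkRep_e_mul_e_neg_sub S Λ hdom i)
  rw [Matrix.trace_sub, Matrix.trace_mul_comm, sub_self, hMat, torusDiag, Matrix.trace_diagonal] at htr
  simp only [corootForm_apply] at htr
  rw [← Int.cast_sum, eq_comm, Int.cast_eq_zero] at htr
  rw [map_sum, LinearMap.sum_apply]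
  exact htr

/-- **The block of root matrices of `L(Λ)`** (`RootRepBlock`, `ChevalleyGroupData.lean`): the
weight basis, the matrices `ρ(e_α)`, homogeneity, `[E_α, E_{-α}] = H_α`, irreducibility, weights
in one coset of the root lattice, trace condition. [folklore] -/
def blk : RootRepBlock k P (BlkIdx S Λ hdom) where
  wt := blkWt S Λ hdom
  E := fun i => blkRep S Λ hdom (e i)
  isHomogMat_E := isHomogMat_blkRep_e S Λ hdom
  E_mul_E_neg_sub := blkRep_e_mul_e_neg_sub S Λ hdom
  irreducible := fun W hE hT => blk_irreducible S Λ hdom W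
    (fun i v hv => by simpa [Matrix.mulVec] using hE i v hv) (fun ℓ v hv => by simpa using hT ℓ v hv)
  wt_sub_wt_mem := blkWt_sub_blkWt_mem S Λ hdom
  sum_wt_coroot := sum_blkWt_coroot S Λ hdom

/-- The weights of the block. [folklore] -/
@[simp] lemma blk_wt : (blk S Λ hdom).wt = blkWt S Λ hdom := rfl

/-- The root matrices of the block. [folklore] -/
@[simp] lemma blk_E (i : ι) : (blk S Λ hdom).E i = blkRep S Λ hdom (e i) := rfl

/-! ### Occurring weights -/

/-- **Every weight of `L(Λ)` is the weight of a basis vector.** [folklore] -/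
theorem exists_blkWt_eq {μ : X} (hμ : μ ∈ wtFinset S Λ hdom) : ∃ a : BlkIdx S Λ hdom, blkWt S Λ hdom a = μ := by
  obtain ⟨j, hj⟩ := exists_wtAt_eq S Λ hdom hμ
  have hne : pieceAt S Λ hdom j ≠ ⊥ := by
    rw [pieceAt, hj]; exact (mem_wtFinset_iff S Λ hdom μ).1 hμ
  have hpos : 0 < blkDim S Λ hdom j := by
    rw [blkDim, pos_iff_ne_zero, Ne, Submodule.finrank_eq_zero]
    exact hne
  exact ⟨⟨j, ⟨0, hpos⟩⟩, hj⟩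

/-- **`Λ` is the weight of a basis vector.** [folklore] -/
theorem exists_blkWt_eq_self : ∃ a : BlkIdx S Λ hdom, blkWt S Λ hdom a = Λ :=
  exists_blkWt_eq S Λ hdom (by rw [wtFinset, Set.Finite.mem_toFinset]; exact self_mem_wtSet S Λ)

/-- **`Λ - α_s` is a weight when `⟨Λ, α_s^∨⟩ > 0`** (`e_{-s} v̄_Λ ≠ 0`). [folklore] -/
theorem exists_blkWt_eq_sub {s : ι} (hs : s ∈ b.support) (h0 : 0 < P.toLinearMap Λ (P.coroot s)) :
    ∃ a : BlkIdx S Λ hdom, blkWt S Λ hdom a = Λ - P.root s := by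
  obtain ⟨m, hm⟩ := Int.eq_ofNat_of_zero_le (hdom s hs)
  have hm0 : 0 < m := by rw [hm] at h0; exact_mod_cast h0
  refine exists_blkWt_eq S Λ hdom ((mem_wtFinset_iff S Λ hdom _).2 ?_)
  have hmem := fIterL_mem_wspL S Λ ⟨s, hs⟩ 1
  rw [one_smul, root_negIdx] at hmem
  rw [show Λ - P.root s - Λ = -P.root s by abel]
  exact (Submodule.ne_bot_iff _).2 ⟨_, hmem, fIterL_one_ne_zero S Λ ⟨s, hs⟩ hm hm0⟩

/-- All weights of the block lie in `Λ +` root lattice. [folklore] -/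
theorem blkWt_sub_self_mem (a : BlkIdx S Λ hdom) :
    blkWt S Λ hdom a - Λ ∈ AddSubgroup.closure (Set.range P.root) := by
  rw [← Submodule.span_int_eq_addSubgroupClosure, Submodule.mem_toAddSubgroup]
  exact blkWt_sub_mem_rootSpan S Λ hdom a

/-- `ρ(h_s) ∈ 𝔱_V` for the block. [folklore] -/
theorem blkRep_h_mem_torusLie (s : b.support) : blkRep S Λ hdom (h s) ∈ torusLie (k := k) (blkWt S Λ hdom) := by
  rw [blkRep_h]; exact torusDiag_mem_torusLie _

end ChevalleyVerma

end Literature.NumberTheory.Automorphic
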